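import Literature.AlgebraicGeometry.HodgeTheory.SymbolClasses
import HarnessLib

/-!
# Route `MilnorKExponential` · crux `SymbolLiftR` · line `lefschetz-fold` · stub S4:
# symbol cocycles on one Hodge model add

For a Hodge model `A` of a smooth complex variety `X` and classes `c, c' ∈ H^{2(q+1)}(X(ℂ); ℂ)`
carried on `A` by Čech cocycles of holomorphic Milnor symbols of weight `q + 1`
(`HodgeModel.HasSymbolCocycle`, file `Literature/AlgebraicGeometry/HodgeTheory/SymbolClasses`),
the sum `c + c'` is so carried (`stub_add`). The tree proves `neg` / `zsmul` / `of_zsmul` (same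
cover); additivity needs the COMMON REFINEMENT `ι × ι'`, `V_{(i,i')} = U_i ∩ U'_{i'}`, of the two
finite open covers, i.e. the restriction of Čech data along a map of index sets `f : κ → ι` with
`V_k ⊆ U_{f k}` (Bott–Tu (1982), §8: restriction to a refinement is a map of double complexes):

* `cechSet_refine_subset` — `V_J ⊆ U_{f ∘ J}`;
* `isMilnorSymbolCocycle_refine` — `J ↦ σ_{f ∘ J}` is a Milnor symbol cocycle of `V` (good chains
  and Milnor relations are antitone in the open set; the Čech differential commutes with the
  re-indexing definitionally);
* `cechδ_refine_apply`, `cechd_refine_apply` — the Čech differential and the vertical differential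
  of the Čech–de Rham double complex commute with the refinement map `Z ↦ (J ↦ Z_{f ∘ J}|_{V_J})`
  on `CechForms`;
* `isTransgression_refine` — hence a zig-zag (`IsTransgression`) of the cover `U` from `w` to `θ`
  refines to a zig-zag of `V` from `J ↦ w_{f ∘ J}` to the same `θ`;
* `hasSymbolCocycle_add` / `stub_add` — refine both data to `ι × ι'` (along `Prod.fst`,
  `Prod.snd`) and combine: cocycle `m' • σ̃ + m • σ̃'`, bottom form `m' • θ + m • θ'`, integer
  `m m'`.

## References

* R. Bott, L. W. Tu, *Differential Forms in Algebraic Topology* (1982), §8 (Prop. 8.5, Prop. 8.8).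
-/

noncomputable section

open scoped Manifold ContDiff

-- `Summit.HodgeConjecture.HodgeConjecture.Theorems.…` is the mandated namespace (single-problem summit:
-- Problem = Summit), which `linter.dupNamespace` flags; the lakefile turns the linter off tree-wide
-- (weak option), restated here so stand-alone elaboration is warning-free too.
set_option linter.dupNamespace false

namespace Summit.HodgeConjecture.HodgeConjecture.Theorems.SymbolLiftR

open Literature.AlgebraicGeometry Literature.AlgebraicGeometry.HodgeTheory
open Literature.Geometry.Kaehler Literature.NumberTheory.Transcendental

/-! ### Refinement of Čech data along a map of index sets -/

section Refinement

variable {M : Type*} {ι κ : Type*} {U : ι → Set M} {V : κ → Set M} {f : κ → ι}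

/-- **Refinement of finite intersections**: if `V_k ⊆ U_{f k}` for every index `k` then
`V_J ⊆ U_{f ∘ J}` for every tuple `J`. [folklore] -/
theorem cechSet_refine_subset (hf : ∀ k, V k ⊆ U (f k)) {n : ℕ} (J : Fin n → κ) :
    cechSet V J ⊆ cechSet U (f ∘ J) :=
  fun _ hx ↦ mem_cechSet_iff.2 fun k ↦ hf (J k) (mem_cechSet_iff.1 hx k)

section Milnor

variable {E : Type*} [NormedAddCommGroup E] [NormedSpace ℂ E] [TopologicalSpace M] [ChartedSpace E M]

/-- **Milnor symbol cocycles restrict to a refinement**: if `σ` is a Milnor symbol `n`-cocycle of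
weight `p` of the cover `U` and `V_k ⊆ U_{f k}`, then `J ↦ σ_{f ∘ J}` is one of `V` (chains of good
tuples and the Milnor relations over `U_{f ∘ J}` are such over the smaller `V_J`,
`goodChains_antitone` / `milnorRel_antitone`; `(δσ̃)_{J'} = (δσ)_{f ∘ J'}` by definition).
[folklore] -/
theorem isMilnorSymbolCocycle_refine (hf : ∀ k, V k ⊆ U (f k)) {n p : ℕ}
    {σ : (Fin (n + 1) → ι) → ((Fin p → M → ℂ) →₀ ℤ)} (h : IsMilnorSymbolCocycle E U σ) :
    IsMilnorSymbolCocycle E V fun J ↦ σ (f ∘ J) :=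
  ⟨fun J ↦ goodChains_antitone (cechSet_refine_subset hf J) p (h.1 (f ∘ J)),
    fun J' ↦ milnorRel_antitone (cechSet_refine_subset hf J') p (h.2 (f ∘ J'))⟩

end Milnor

section Forms

variable {E : Type*} [NormedAddCommGroup E] [NormedSpace ℝ E]
  {H : Type*} [TopologicalSpace H] {I : ModelWithCorners ℝ E H}
  [TopologicalSpace M] [ChartedSpace H M]
  {F : Type*} [NormedAddCommGroup F] [NormedSpace ℝ F]

/-- **The Čech differential commutes with refinement**: for a cochain `Z ∈ C^a(𝔘, Ω^b)` and the
refined cochain `Z̃_J = Z_{f ∘ J}|_{V_J}` one has `(δ Z̃)_J = (δ Z)_{f ∘ J}|_{V_J}` (restricting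
twice is restricting once, and the faces of `f ∘ J` are the `f ∘ (J ∘ σ_j)`).
[cite: BottTu1982Forms, §8 (8.4)] -/
theorem cechδ_refine_apply (hU : ∀ i, IsOpen (U i)) (hV : ∀ k, IsOpen (V k))
    (hf : ∀ k, V k ⊆ U (f k)) {a b : ℕ} (Z : CechForms I F U a b) (J : Fin (a + 2) → κ) :
    cechδ I F hV a b (fun J ↦ restrictₗ I F b (isOpen_cechSet hV J) (cechSet_refine_subset hf J)
        (Z (f ∘ J))) J =
      restrictₗ I F b (isOpen_cechSet hV J) (cechSet_refine_subset hf J)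
        (cechδ I F hU a b Z (f ∘ J)) := by
  apply Subtype.ext
  simp only [coe_cechδ_apply, coe_restrictₗ, MForm.restr_sum, MForm.restr_smul]
  refine Finset.sum_congr rfl fun j _ ↦ ?_
  rw [MForm.restr_restr_of_subset (cechSet_subset_comp V J (Fin.succAbove j)),
    MForm.restr_restr_of_subset (cechSet_refine_subset hf J)]
  rfl

variable [IsManifold I ∞ M]

/-- **The vertical differential commutes with refinement**: `(cechd Z̃)_J = (cechd Z)_{f ∘ J}|_{V_J}`
(`d` commutes with restriction to an open subset, `localD_restrictₗ`). [cite: BottTu1982Forms, §8 Prop. 8.8] -/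
theorem cechd_refine_apply (hU : ∀ i, IsOpen (U i)) (hV : ∀ k, IsOpen (V k))
    (hf : ∀ k, V k ⊆ U (f k)) {a b : ℕ} (Z : CechForms I F U a b) (J : Fin (a + 1) → κ) :
    cechd I F hV a b (fun J ↦ restrictₗ I F b (isOpen_cechSet hV J) (cechSet_refine_subset hf J)
        (Z (f ∘ J))) J =
      restrictₗ I F (b + 1) (isOpen_cechSet hV J) (cechSet_refine_subset hf J)
        (cechd I F hU a b Z (f ∘ J)) := by
  rw [cechd_apply, cechd_apply, map_smul, localD_restrictₗ _ (isOpen_cechSet hU (f ∘ J))]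

/-- **Zig-zags restrict to a refinement**: if `θ` is reached from the Čech cochain `w` of the
cover `U` by a zig-zag `Z` through the Čech–de Rham double complex (`IsTransgression`), and
`V_k ⊆ U_{f k}` is a refinement along `f`, then `θ` is reached from `J ↦ w_{f ∘ J}` by the refined
zig-zag `Z̃_J = Z_{f ∘ J}|_{V_J}` of the cover `V` (refinement is a map of double complexes,
`cechδ_refine_apply` / `cechd_refine_apply`; top and bottom are read off on `V_J ⊆ U_{f ∘ J}`).
[cite: BottTu1982Forms, §8 Prop. 8.8] -/
theorem isTransgression_refine {hU : ∀ i, IsOpen (U i)} (hV : ∀ k, IsOpen (V k))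
    (hf : ∀ k, V k ⊆ U (f k)) {q : ℕ} {w : (Fin (q + 2) → ι) → MForm I M F (q + 1)}
    {θ : MForm I M F (2 * q + 1 + 1)} (h : IsTransgression hU q w θ) :
    IsTransgression hV q (fun J ↦ w (f ∘ J)) θ := by
  obtain ⟨Z, ht, hs, hb⟩ := h
  refine ⟨fun a b J ↦ restrictₗ I F b (isOpen_cechSet hV J) (cechSet_refine_subset hf J)
    (Z a b (f ∘ J)), fun J x hx ↦ ?_, fun a b hab ha ↦ ?_, fun J x hx ↦ ?_⟩
  · -- top: `(δ Z̃)_J = (δ Z)_{f ∘ J}|_{V_J} = w_{f ∘ J}` on `V_J`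
    rw [cechδ_refine_apply hU hV hf, coe_restrictₗ, MForm.restr_apply_of_mem _ hx,
      ht (f ∘ J) x (cechSet_refine_subset hf J hx)]
  · -- steps: both sides are refinements of the two sides of the step for `Z`
    funext J
    rw [cechd_refine_apply hU hV hf, cechδ_refine_apply hU hV hf, hs a b hab ha]
  · -- bottom: `(cechd Z̃)_J = (cechd Z)_{f ∘ J}|_{V_J} = θ` on `V_J`
    rw [cechd_refine_apply hU hV hf, coe_restrictₗ, MForm.restr_apply_of_mem _ hx,
      hb (f ∘ J) x (cechSet_refine_subset hf J hx)]

end Forms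

end Refinement

/-! ### Additivity of symbol cocycles on one Hodge model -/

section HodgeTheory

variable {n : ℕ} {X : Motives.SchemeOver ℂ}

/-- **Symbol cocycles on one Hodge model add.** If `c` and `c'` have weight-`(q+1)` symbol
cocycles on the SAME Hodge model `A` — data `(U, σ, θ, m)` and `(U', σ', θ', m')` — then so does
`c + c'`: on the common refinement `V_{(i,i')} = U_i ∩ U'_{i'}` (a finite open cover) take the
Milnor cocycle `m' • σ̃ + m • σ̃'` of the refined cocycles (`isMilnorSymbolCocycle_refine`; Milnor
cocycles form the subgroup `milnorSymbolCocycles`), the closed form `m' • θ + m • θ'`, which is a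
transgression of its symbol forms (`isTransgression_refine`, `symbolForm` is additive,
`IsTransgression.add/smul`), and the integer `m m' ≠ 0`:
`A.deRham [m' θ + m θ'] = m' m A^*c + m m' A^*c' = (m m') • A^*(c + c')`. [folklore] -/
theorem hasSymbolCocycle_add {A : HodgeModel n X} {q : ℕ} {c c' : complexBetti X (2 * (q + 1))}
    (h : A.HasSymbolCocycle q c) (h' : A.HasSymbolCocycle q c') : A.HasSymbolCocycle q (c + c') := by
  obtain ⟨ι, _, U, hU, hcov, σ, hσ, θ, m, hm, hT, hc⟩ := h
  obtain ⟨ι', _, U', hU', hcov', σ', hσ', θ', m', hm', hT', hc'⟩ := h'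
  -- the common refinement
  let V : ι × ι' → Set A.carrier := fun k ↦ U k.1 ∩ U' k.2
  have hV : ∀ k, IsOpen (V k) := fun k ↦ (hU k.1).inter (hU' k.2)
  have hVcov : ∀ x, ∃ k, x ∈ V k := fun x ↦ by
    obtain ⟨i, hi⟩ := hcov x
    obtain ⟨i', hi'⟩ := hcov' x
    exact ⟨(i, i'), hi, hi'⟩
  have hf : ∀ k : ι × ι', V k ⊆ U k.1 := fun _ ↦ Set.inter_subset_left
  have hf' : ∀ k : ι × ι', V k ⊆ U' k.2 := fun _ ↦ Set.inter_subset_right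
  -- the refined data
  have hσV : IsMilnorSymbolCocycle A.model V fun J ↦ σ (Prod.fst ∘ J) :=
    isMilnorSymbolCocycle_refine hf hσ
  have hσV' : IsMilnorSymbolCocycle A.model V fun J ↦ σ' (Prod.snd ∘ J) :=
    isMilnorSymbolCocycle_refine hf' hσ'
  have hTV : IsTransgression hV q (fun J ↦ symbolForm A.model (q + 1) (σ (Prod.fst ∘ J))) θ :=
    isTransgression_refine hV hf hT
  have hTV' : IsTransgression hV q (fun J ↦ symbolForm A.model (q + 1) (σ' (Prod.snd ∘ J))) θ' :=
    isTransgression_refine hV hf' hT'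
  -- the combination
  let τ : (Fin (q + 2) → ι × ι') → ((Fin (q + 1) → (A.carrier → ℂ)) →₀ ℤ) :=
    m' • (fun J ↦ σ (Prod.fst ∘ J)) + m • fun J ↦ σ' (Prod.snd ∘ J)
  have hτ : IsMilnorSymbolCocycle A.model V τ :=
    ((milnorSymbolCocycles A.model V (q + 1) (q + 1)).zsmul_mem hσV m').add
      ((milnorSymbolCocycles A.model V (q + 1) (q + 1)).zsmul_mem hσV' m)
  refine ⟨ι × ι', inferInstance, V, hV, hVcov, τ, hτ, (m' : ℂ) • θ + (m : ℂ) • θ', m * m',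
    mul_ne_zero hm hm', ?_, ?_⟩
  · -- the transgression: linearity
    have hk : ∀ (k : ℤ) (s : (Fin (q + 1) → (A.carrier → ℂ)) →₀ ℤ),
        symbolForm A.model (q + 1) (k • s) = (k : ℝ) • symbolForm A.model (q + 1) s := fun k s ↦ by
      rw [Int.cast_smul_eq_zsmul]
      exact map_zsmul (symbolFormHom A.model (q + 1)) k s
    have e : (fun J ↦ symbolForm A.model (q + 1) (τ J)) =
        (m' : ℝ) • (fun J ↦ symbolForm A.model (q + 1) (σ (Prod.fst ∘ J))) +
          (m : ℝ) • fun J ↦ symbolForm A.model (q + 1) (σ' (Prod.snd ∘ J)) := by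
      funext J
      simp only [τ, Pi.add_apply, Pi.smul_apply, symbolForm_add, hk]
    have e' : ((((m' : ℂ) • θ + (m : ℂ) • θ' :
          cclosedSmoothForms A.model A.carrier (2 * q + 1 + 1)) :
            MForm 𝓘(ℝ, A.model) A.carrier ℂ (2 * q + 1 + 1))) =
        (m' : ℝ) • (θ : MForm 𝓘(ℝ, A.model) A.carrier ℂ (2 * q + 1 + 1)) +
          (m : ℝ) • (θ' : MForm 𝓘(ℝ, A.model) A.carrier ℂ (2 * q + 1 + 1)) := by
      rw [Submodule.coe_add, Submodule.coe_smul, Submodule.coe_smul, Int.cast_smul_eq_zsmul,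
        Int.cast_smul_eq_zsmul, Int.cast_smul_eq_zsmul, Int.cast_smul_eq_zsmul]
    rw [e, e']
    exact (hTV.smul (m' : ℝ)).add (hTV'.smul (m : ℝ))
  · -- the class: `A.deRham [m' θ + m θ'] = (m m') • A^*(c + c')`
    rw [map_add, map_add, map_smul, map_smul, map_smul, map_smul, hc, hc', map_add, smul_add,
      smul_smul, smul_smul, Int.cast_mul, mul_comm (m' : ℂ)]

/-- STUB S4 of the line `lefschetz-fold` (crux `SymbolLiftR`, item stmt-HodgeConjecture-18702):
**symbol cocycles on one Hodge model add** — the registered text, closed by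
`hasSymbolCocycle_add` (common refinement of the two covers). [folklore] -/
theorem stub_add : ∀ ⦃n : ℕ⦄ ⦃X : Motives.SchemeOver ℂ⦄ (A : HodgeModel n X) (q : ℕ) (c c' : complexBetti X (2 * (q + 1))), A.HasSymbolCocycle q c → A.HasSymbolCocycle q c' → A.HasSymbolCocycle q (c + c') :=
  fun _ _ _ _ _ _ h h' ↦ hasSymbolCocycle_add h h'

end HodgeTheory

end Summit.HodgeConjecture.HodgeConjecture.Theorems.SymbolLiftR
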